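import Summits.ResolutionOfSingularities.ResolutionOfSingularities.Theorems.PurelyInseparableDim4UniformLocalCert
import Summits.ResolutionOfSingularities.ResolutionOfSingularities.Theorems.PurelyInseparableDim4HopRegionsLocalEscapeUniform
import Summits.ResolutionOfSingularities.ResolutionOfSingularities.Theorems.PurelyInseparableDim4UniformSources
import HarnessLib

/-!
# [OURS · res-dim4-pi · F4-C-loc] ALL-FIELDS LIFT OF LOOP-D `d1 … d6` AND OF F3's ROOT `fc0` (uniform local win
  certificates, format v2 with DEAD ORIGINS), and the honest limit at the two roots `d0`, `fc3`: whatever A plays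
  first, B keeps a WHOLE CHART FIBRE of replies over every field

Cell `res-dim4-pi` (D-0157 DOOR 2, wave 2), seat `res-dim4-p-6` g3 (desk WORD #66 (3)(a): all-fields lift of the
LOOP-D / F1–F3 local wins; g2 left LOOP-D's line states and F3's `fc0`/`fc3`).  res-dim4-p-8 g2's literal data
(`…HopRegions`, p662859) and the seat's `𝔽₃` certificates (`…HopRegionsLocalEscape`, p668681) are the input; the
format is the seat's `uwinCertB` (`…UniformLocalCert`, p672864) with ONE more chart option.

* §1 **format v2 `uwinCert2B`.**  A row is `(s, S, w, frc, dead)`: as in `uwinCertB` (per chart `j ∈ S` a maximal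
  witness `w j = some γ`, or `w j = none` and an origin-forcing pair `frc j i` for every free coordinate
  `i ∈ S ∖ {j}`), plus for a forcing chart the option `dead j = some γ₀` — **`originDeadB`**: a low exponent
  `γ₀ ≠ 0`, `|γ₀| < q`, with non-zero coefficient in the chart transform itself, so that the chart ORIGIN (the only
  possible reply after forcing) is not equimultiple over any field (`not_isEquimultiplePoint_zero_of_originDeadB`);
  otherwise (`dead j = none`) the origin child is `0` or a later row, as before.  Soundness over every field
  extension: **`rWins_lift_of_uwinCert2B`** (the v1 proof with one more case).  Why v2: at the LOOP-D line states the
  second move forces B to the chart origin where `x₁` (resp. `x₂`, `x₄`) survives with coefficient `±1` — the origin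
  is dead but its formal child is not `3`-fold, so v1 (which wants the child as a ROW with a permissible centre)
  cannot close the branch.
* §2 the tables (‖ K, `decide +kernel`; generated by the seat's solver `work/sim/usolve.py` from p-8's literal states,
  children written as `StepKit.stepD` terms): `d1UCert … d6UCert` (two rows each: the line through the state twice),
  `fc0UCert` (two rows: `V(x₁,x₄)` then `V(x₂,x₄)` at the origin child `= fc1`).
* §3 **`d1_localWin_allFields … d6_localWin_allFields`, `fc0_localWin_allFields`**, and the region forms
  **`loopD_localWins_allFields_of_ne_d0`** (every LOOP-D state other than the root, over EVERY field of
  characteristic 3) and **`f3_localWins_allFields_of_ne_fc3`** (every F3 state other than `fc3`; `fc1/fc2/fc4/fc5/fc6`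
  are `…HopRegionsLocalEscapeUniform`).
* §4 **the honest limit, as a theorem**: at the roots `d0 = x₃²x₄⁴ − x₁⁴x₂⁴` and `fc3 = x₃⁵x₄² + x₁x₂x₄⁴`, for EVERY
  permissible coordinate centre `S` there is a chart `j ∈ S` in which NO low exponent has a source at all
  (`UniformNoReply.sourcesB … γ [] = true` for every low `γ`, ‖ K), hence **every** point of that chart's fibre over
  the current point is equimultiple over every field (`d0_free_fibre`, `fc3_free_fibre`): over an infinite field
  B has infinitely many first replies whatever A does, so no finite table of `𝔽₃`-rational rows decides the two
  roots (they need the fibre coordinate as a letter) — a statement about the FORMAT's reach, not a B-win.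
Scope (honest): statements about OUR frame's LOCAL game `LoopCLocal.RWins 3 localB`; F4-C-loc(3,3) in its ∃-rule
form is OPEN; NOTHING here is a statement about resolution of singularities — resolution in dimension `≥ 4` /
characteristic `p > 0` is NOT proved by anything in this file.  [OURS · counted 0 · AI kernel work, weaker than
expert review.]  bears_on: LADDER-RESOLUTION:D157-DOOR2 (res-dim4-pi · F4-C-loc(3,3) all fields · LOOP-D / F3).
Host item (DR-157-C): `stmt-ResolutionOfSingularities-16155`, helper.
-/

set_option linter.dupNamespace false -- mandated namespace of this single-conjunct summit

noncomputable section

open MvPolynomial Finset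
open scoped BigOperators

namespace Summit.ResolutionOfSingularities.ResolutionOfSingularities.Theorems.PIDim4

namespace LoopCLocal

open Literature.AlgebraicGeometry.Resolution
open Literature.AlgebraicGeometry.Resolution.CentreBlowup
open StepKit LoopC UniformNoReply

section Generic

variable {k K : Type} [Field k] [Field K] [DecidableEq k] [DecidableEq K] (f : k →+* K)

/-! ## §1 Format v2: dead origins -/

/-- **Origin-kill check** for the chart `j` of the blow-up of `C_S`: a low exponent `γ ≠ 0`, `|γ| < q`, with
non-zero coefficient in the chart transform itself (= the point transform at the chart origin). OURS. [folklore] -/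
def originDeadB (q : ℕ) (S : Finset (Fin 4)) (j : Fin 4) (F : Terms 4 k) (γ : Fin 4 → ℕ) : Bool :=
  !decide (γ = 0) && decide (∑ i, γ i < q) && !decide (coeffAt (chartL q S j F) γ = 0)

omit [DecidableEq K] in
/-- **A dead origin stays dead over every field**: the chart origin of a lifted state is not equimultiple
(translation by `0` is the identity, coefficients go up along the injective `f`). OURS. [folklore] -/
theorem not_isEquimultiplePoint_zero_of_originDeadB {q : ℕ} {S : Finset (Fin 4)} {j : Fin 4} {s : SData 4 k}
    {γ : Fin 4 → ℕ} (h : originDeadB q S j s.L γ = true) :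
    ¬ IsEquimultiplePoint q S j (0 : Fin 4 → K) (liftHom f s.toState) := by
  simp only [originDeadB, Bool.and_eq_true, Bool.not_eq_true', decide_eq_false_iff_not,
    decide_eq_true_eq] at h
  obtain ⟨⟨h0, hdeg⟩, hc⟩ := h
  intro heq
  have hz := heq (expo γ) ((not_congr (expo_eq_zero_iff γ)).mpr h0) (by rw [degree_expo]; exact hdeg)
  rw [liftHom, pointTransform_baseChange_evalT, PointBlowup.translate_zero, coeff_map, coeff_expo_evalT,
    map_eq_zero_iff f f.injective] at hz
  exact hc hz

/-- a v2 row: presented state, A's centre, per chart an optional maximal witness, per chart and free coordinate a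
forcing pair, per chart an optional origin-killing exponent. OURS. [folklore] -/
abbrev URow2 (k : Type) : Type :=
  SData 4 k × Finset (Fin 4) × (Fin 4 → Option (Fin 4 → ℕ)) × (Fin 4 → Fin 4 → (Fin 4 → ℕ) × (Fin 4 → ℕ)) ×
    (Fin 4 → Option (Fin 4 → ℕ))

/-- a v2 uniform local win certificate: a list of rows, parents before children. OURS. [folklore] -/
abbrev UCert2 (k : Type) : Type := List (URow2 k)

/-- the origin check of a forcing chart: dead by `γ₀`, or the origin child is `0` or a later row. OURS. [folklore] -/
def uchild2OK (q : ℕ) (rest : UCert2 k) (s : SData 4 k) (S : Finset (Fin 4)) (j : Fin 4)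
    (d : Option (Fin 4 → ℕ)) : Bool :=
  match d with
  | some γ => originDeadB q S j s.L γ
  | none => StepKit.equivB (stepD q S j 0 s).L [] || rest.any fun r => (stepD q S j 0 s).equivB r.1

/-- the v2 row check. OURS. [folklore] -/
def urow2OK (q : ℕ) (rest : UCert2 k) (row : URow2 k) : Bool :=
  permB q row.2.1 row.1.L &&
    decide (∀ j ∈ row.2.1, chartOK q row.2.1 j row.1.L (row.2.2.1 j) (row.2.2.2.1 j) = true ∧
      (row.2.2.1 j = none → uchild2OK q rest row.1 row.2.1 j (row.2.2.2.2 j) = true))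

/-- **the v2 uniform local win-certificate checker.** OURS. [folklore] -/
def uwinCert2B (q : ℕ) : UCert2 k → Bool
  | [] => true
  | row :: rest => urow2OK q rest row && uwinCert2B q rest

/-- **Soundness of one v2 row** (as `rWins_lift_of_urowOK`, plus: a reply forced to a dead origin is impossible).
OURS. [folklore] -/
theorem rWins_lift_of_urow2OK {q : ℕ} {rest : UCert2 k}
    (hrest : ∀ r ∈ rest, RWins q localB (liftHom f r.1.toState))
    {row : URow2 k} (h : urow2OK q rest row = true) : RWins q localB (liftHom f row.1.toState) := by
  obtain ⟨s, S, w, frc, d⟩ := row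
  simp only [urow2OK, Bool.and_eq_true, decide_eq_true_eq] at h
  obtain ⟨hperm, hall⟩ := h
  by_cases hsc : InCoordinateScope q (liftHom f s.toState).F
  · refine Game.Wins.move (m := S) (legal_liftHom f hsc hperm) ?_
    rintro s' ⟨j, b, hj, hbj, hloc, heq, hne, rfl⟩
    have hb := (localB_eq_true_iff S j b).mp hloc
    obtain ⟨hchart, hchild⟩ := hall j hj
    cases hw : w j with
    | some γ =>
      rw [hw] at hchart
      exact absurd heq (not_isEquimultiplePoint_of_uniformWitnessB f hchart (vanish_erase K hbj hb))
    | none =>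
      rw [hw] at hchart
      simp only [chartOK, decide_eq_true_eq] at hchart
      have hb0 : b = 0 := by
        funext m
        by_cases hmj : m = j
        · rw [hmj]; exact hbj
        by_cases hmS : m ∈ S
        · exact coord_eq_zero_of_forcesCoordB f (hchart m (Finset.mem_erase.mpr ⟨hmj, hmS⟩)) hbj hb heq
        · exact hb m hmS
      subst hb0
      have hc := hchild hw
      cases hd : d j with
      | some γ₀ =>
        rw [hd] at hc
        exact absurd heq (not_isEquimultiplePoint_zero_of_originDeadB f hc)
      | none =>
        rw [hd] at hc
        rw [step_origin_liftHom] at hne ⊢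
        unfold uchild2OK at hc
        rw [Bool.or_eq_true] at hc
        rcases hc with hzero | hmem
        · exfalso
          apply hne
          show MvPolynomial.map f (evalT (stepD q S j 0 s).L) = 0
          rw [(evalT_eq_zero_iff _).mpr hzero, map_zero]
        · obtain ⟨r, hr, hrc⟩ := List.any_eq_true.mp hmem
          rw [(toState_eq_iff _ _).mpr hrc]
          exact hrest r hr
  · exact Game.Wins.terminal fun _ hS' => hsc hS'.1

/-- **SOUNDNESS OF v2 UNIFORM LOCAL WIN CERTIFICATES**: every row of a checked table, base-changed along any ring
map of fields `f : k →+* K`, is an A-win of the LOCAL in-scope game over `K`. OURS. [folklore] -/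
theorem rWins_lift_of_uwinCert2B {q : ℕ} :
    ∀ {T : UCert2 k}, uwinCert2B q T = true → ∀ row ∈ T, RWins q localB (liftHom f row.1.toState)
  | [], _ => fun row hrow => absurd hrow List.not_mem_nil
  | row :: rest, h => by
    unfold uwinCert2B at h
    rw [Bool.and_eq_true] at h
    have hrest := rWins_lift_of_uwinCert2B h.2
    intro r hr
    rcases List.mem_cons.mp hr with rfl | hr'
    · exact rWins_lift_of_urow2OK f hrest h.1
    · exact hrest r hr'

/-- the head row of a checked v2 table, lifted, is an A-win. OURS. [folklore] -/
theorem rWins_lift_of_uwinCert2B_head {q : ℕ} {row : URow2 k} {rest : UCert2 k}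
    (h : uwinCert2B q (row :: rest) = true) : RWins q localB (liftHom f row.1.toState) :=
  rWins_lift_of_uwinCert2B f h row List.mem_cons_self

end Generic

/-! ## §2 The tables (‖ K) -/

/-- no forcing pairs in this chart (filler). [OURS · data] -/
def noF : Fin 4 → (Fin 4 → ℕ) × (Fin 4 → ℕ) := ![(0, 0), (0, 0), (0, 0), (0, 0)]

/-- LOOP-D `d1` (`dL3 = x₁x₃²(x₄+1)⁴ − x₁x₂⁴`, `r = (1,0,0,0)`, `exc = {x₁}`): the line `V(x₁,x₂,x₃)` twice; charts
`x₁`/`x₃` witnessed (`x₃²`, `x₁` resp. `x₁x₄`), chart `x₂` forced to its origin (`x₃² ← x₁x₃²`, `x₁ ← x₁x₃²` resp.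
`x₁x₄ ← x₁x₃²x₄`), whose second occurrence is DEAD by `x₁` (coefficient `2`). [OURS · ‖ K data] -/
def d1UCert : UCert2 (ZMod 3) :=
  [(d1, {0, 1, 2}, ![some ![0, 0, 2, 0], none, some ![1, 0, 0, 0], none],
      ![noF, ![(![0, 0, 2, 0], ![1, 0, 2, 0]), (0, 0), (![1, 0, 0, 0], ![1, 0, 2, 0]), (0, 0)], noF, noF],
      ![none, none, none, none]),
   (stepD 3 {0, 1, 2} 1 ![0, 0, 0, 0] d1, {0, 1, 2}, ![some ![0, 0, 2, 0], none, some ![1, 0, 0, 1], none],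
      ![noF, ![(![0, 0, 2, 0], ![1, 0, 2, 0]), (0, 0), (![1, 0, 0, 1], ![1, 0, 2, 1]), (0, 0)], noF, noF],
      ![none, some ![1, 0, 0, 0], none, none])]

/-- it checks. [OURS · ‖ K] -/
theorem uwinCert2B_d1 : uwinCert2B 3 d1UCert = true := by decide +kernel

/-- LOOP-D `d2` (`dL1`, the `x₁ ↔ x₂` mirror of `d1`): line `V(x₁,x₂,x₃)` twice, chart `x₁` forced then dead by `x₂`.
[OURS · ‖ K data] -/
def d2UCert : UCert2 (ZMod 3) :=
  [(d2, {0, 1, 2}, ![none, some ![0, 0, 2, 0], some ![0, 1, 0, 0], none],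
      ![![(0, 0), (![0, 0, 2, 0], ![0, 1, 2, 0]), (![0, 1, 0, 0], ![0, 1, 2, 0]), (0, 0)], noF, noF, noF],
      ![none, none, none, none]),
   (stepD 3 {0, 1, 2} 0 ![0, 0, 0, 0] d2, {0, 1, 2}, ![none, some ![0, 0, 2, 0], some ![0, 1, 0, 1], none],
      ![![(0, 0), (![0, 0, 2, 0], ![0, 1, 2, 0]), (![0, 1, 0, 1], ![0, 1, 2, 1]), (0, 0)], noF, noF, noF],
      ![some ![0, 1, 0, 0], none, none, none])]

/-- it checks. [OURS · ‖ K] -/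
theorem uwinCert2B_d2 : uwinCert2B 3 d2UCert = true := by decide +kernel

/-- LOOP-D `d3` (`dL2`, `exc = {x₂,x₃}`): line `V(x₂,x₃,x₄)` twice, chart `x₄` forced then dead by `x₂`.
[OURS · ‖ K data] -/
def d3UCert : UCert2 (ZMod 3) :=
  [(d3, {1, 2, 3}, ![none, some ![0, 0, 2, 0], some ![0, 1, 0, 0], none],
      ![noF, noF, noF, ![(0, 0), (![0, 0, 0, 2], ![0, 1, 0, 2]), (![0, 1, 0, 0], ![0, 1, 2, 0]), (0, 0)]],
      ![none, none, none, none]),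
   (stepD 3 {1, 2, 3} 3 ![0, 0, 0, 0] d3, {1, 2, 3}, ![none, some ![0, 0, 0, 2], some ![1, 1, 0, 0], none],
      ![noF, noF, noF, ![(0, 0), (![0, 0, 2, 0], ![0, 1, 2, 0]), (![0, 1, 1, 0], ![0, 1, 2, 0]), (0, 0)]],
      ![none, none, none, some ![0, 1, 0, 0]])]

/-- it checks. [OURS · ‖ K] -/
theorem uwinCert2B_d3 : uwinCert2B 3 d3UCert = true := by decide +kernel

/-- LOOP-D `d4` (`dL1`, `exc = {x₂,x₃}`): as `d2`. [OURS · ‖ K data] -/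
def d4UCert : UCert2 (ZMod 3) :=
  [(d4, {0, 1, 2}, ![none, some ![0, 0, 2, 0], some ![0, 1, 0, 0], none],
      ![![(0, 0), (![0, 0, 2, 0], ![0, 1, 2, 0]), (![0, 1, 0, 0], ![0, 1, 2, 0]), (0, 0)], noF, noF, noF],
      ![none, none, none, none]),
   (stepD 3 {0, 1, 2} 0 ![0, 0, 0, 0] d4, {0, 1, 2}, ![none, some ![0, 0, 2, 0], some ![0, 1, 0, 1], none],
      ![![(0, 0), (![0, 0, 2, 0], ![0, 1, 2, 0]), (![0, 1, 0, 1], ![0, 1, 2, 1]), (0, 0)], noF, noF, noF],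
      ![some ![0, 1, 0, 0], none, none, none])]

/-- it checks. [OURS · ‖ K] -/
theorem uwinCert2B_d4 : uwinCert2B 3 d4UCert = true := by decide +kernel

/-- LOOP-D `d5` (`dL4`, `exc = {x₁,x₃}`): line `V(x₁,x₃,x₄)` twice, chart `x₄` forced then dead by `x₁`.
[OURS · ‖ K data] -/
def d5UCert : UCert2 (ZMod 3) :=
  [(d5, {0, 2, 3}, ![some ![0, 0, 2, 0], none, some ![1, 0, 0, 0], none],
      ![noF, noF, noF, ![(![0, 0, 0, 2], ![1, 0, 0, 2]), (0, 0), (![1, 0, 0, 0], ![1, 0, 2, 0]), (0, 0)]],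
      ![none, none, none, none]),
   (stepD 3 {0, 2, 3} 3 ![0, 0, 0, 0] d5, {0, 2, 3}, ![some ![0, 0, 0, 2], none, some ![1, 1, 0, 0], none],
      ![noF, noF, noF, ![(![0, 0, 2, 0], ![1, 0, 2, 0]), (0, 0), (![1, 0, 1, 0], ![1, 0, 2, 0]), (0, 0)]],
      ![none, none, none, some ![1, 0, 0, 0]])]

/-- it checks. [OURS · ‖ K] -/
theorem uwinCert2B_d5 : uwinCert2B 3 d5UCert = true := by decide +kernel

/-- LOOP-D `d6` (`dL3`, `exc = {x₁,x₃}`): as `d1`. [OURS · ‖ K data] -/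
def d6UCert : UCert2 (ZMod 3) :=
  [(d6, {0, 1, 2}, ![some ![0, 0, 2, 0], none, some ![1, 0, 0, 0], none],
      ![noF, ![(![0, 0, 2, 0], ![1, 0, 2, 0]), (0, 0), (![1, 0, 0, 0], ![1, 0, 2, 0]), (0, 0)], noF, noF],
      ![none, none, none, none]),
   (stepD 3 {0, 1, 2} 1 ![0, 0, 0, 0] d6, {0, 1, 2}, ![some ![0, 0, 2, 0], none, some ![1, 0, 0, 1], none],
      ![noF, ![(![0, 0, 2, 0], ![1, 0, 2, 0]), (0, 0), (![1, 0, 0, 1], ![1, 0, 2, 1]), (0, 0)], noF, noF],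
      ![none, some ![1, 0, 0, 0], none, none])]

/-- it checks. [OURS · ‖ K] -/
theorem uwinCert2B_d6 : uwinCert2B 3 d6UCert = true := by decide +kernel

/-- F3's root `fc0` (`fcL0 = x₄⁴ + x₁x₂x₄²(1+x₃)⁵`): plane `V(x₁,x₄)` — chart `x₄` witnessed by `x₄`, chart `x₁`
forced to its origin (`x₂ ← x₂x₄²`) whose child (= `fc1`) is won at once by `V(x₂,x₄)` (witnesses `x₄²`, `x₂`).
[OURS · ‖ K data] -/
def fc0UCert : UCert2 (ZMod 3) :=
  [(fc0, {0, 3}, ![none, none, none, some ![0, 0, 0, 1]],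
      ![![(0, 0), (0, 0), (0, 0), (![0, 1, 0, 0], ![0, 1, 0, 2])], noF, noF, noF],
      ![none, none, none, none]),
   (stepD 3 {0, 3} 0 ![0, 0, 0, 0] fc0, {1, 3}, ![none, some ![0, 0, 0, 2], none, some ![0, 1, 0, 0]],
      ![noF, noF, noF, noF], ![none, none, none, none])]

/-- it checks. [OURS · ‖ K] -/
theorem uwinCert2B_fc0 : uwinCert2B 3 fc0UCert = true := by decide +kernel

/-! ## §3 The lifts -/
section AllFields
variable (L : Type) [Field L] [CharP L 3] [DecidableEq L]

/-- **LOOP-D `d1` is a local A-win over EVERY field of characteristic 3.** [OURS · ‖ K] -/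
theorem d1_localWin_allFields : RWins 3 localB (liftState L d1.toState) := by
  have h := rWins_lift_of_uwinCert2B_head (φ3 L) uwinCert2B_d1
  exact h

/-- LOOP-D `d2` over every field of characteristic 3. [OURS · ‖ K] -/
theorem d2_localWin_allFields : RWins 3 localB (liftState L d2.toState) := by
  have h := rWins_lift_of_uwinCert2B_head (φ3 L) uwinCert2B_d2
  exact h

/-- LOOP-D `d3` over every field of characteristic 3. [OURS · ‖ K] -/
theorem d3_localWin_allFields : RWins 3 localB (liftState L d3.toState) := by
  have h := rWins_lift_of_uwinCert2B_head (φ3 L) uwinCert2B_d3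
  exact h

/-- LOOP-D `d4` over every field of characteristic 3. [OURS · ‖ K] -/
theorem d4_localWin_allFields : RWins 3 localB (liftState L d4.toState) := by
  have h := rWins_lift_of_uwinCert2B_head (φ3 L) uwinCert2B_d4
  exact h

/-- LOOP-D `d5` over every field of characteristic 3. [OURS · ‖ K] -/
theorem d5_localWin_allFields : RWins 3 localB (liftState L d5.toState) := by
  have h := rWins_lift_of_uwinCert2B_head (φ3 L) uwinCert2B_d5
  exact h

/-- LOOP-D `d6` over every field of characteristic 3. [OURS · ‖ K] -/
theorem d6_localWin_allFields : RWins 3 localB (liftState L d6.toState) := by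
  have h := rWins_lift_of_uwinCert2B_head (φ3 L) uwinCert2B_d6
  exact h

/-- **F3's root `fc0` is a local A-win over EVERY field of characteristic 3.** [OURS · ‖ K] -/
theorem fc0_localWin_allFields : RWins 3 localB (liftState L fc0.toState) := by
  have h := rWins_lift_of_uwinCert2B_head (φ3 L) uwinCert2B_fc0
  exact h

/-- **LOOP-D lifts away from its root**: every state of p-8's region `dR` other than `d0`, over EVERY field of
characteristic 3, is an A-win of the LOCAL in-scope game. [OURS · ‖ K] -/
theorem loopD_localWins_allFields_of_ne_d0 :
    ∀ s ∈ trapSet dR, s ≠ d0.toState → RWins 3 localB (liftState L s) := by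
  rintro s ⟨sw, hsw, rfl⟩ hne
  simp only [dR, List.mem_cons, List.not_mem_nil, or_false] at hsw
  rcases hsw with rfl | rfl | rfl | rfl | rfl | rfl | rfl
  · exact absurd rfl hne
  · exact d1_localWin_allFields L
  · exact d2_localWin_allFields L
  · exact d3_localWin_allFields L
  · exact d4_localWin_allFields L
  · exact d5_localWin_allFields L
  · exact d6_localWin_allFields L

/-- **F3 lifts away from `fc3`**: every state of p-8's region `fcR` other than `fc3`, over EVERY field of
characteristic 3, is an A-win of the LOCAL in-scope game. [OURS · ‖ K] -/
theorem f3_localWins_allFields_of_ne_fc3 :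
    ∀ s ∈ trapSet fcR, s ≠ fc3.toState → RWins 3 localB (liftState L s) := by
  rintro s ⟨sw, hsw, rfl⟩ hne
  simp only [fcR, List.mem_cons, List.not_mem_nil, or_false] at hsw
  rcases hsw with rfl | rfl | rfl | rfl | rfl | rfl | rfl
  · exact fc0_localWin_allFields L
  · exact fc1_localWin_allFields L
  · exact fc2_localWin_allFields L
  · exact absurd rfl hne
  · exact fc4_localWin_allFields L
  · exact fc5_localWin_allFields L
  · exact fc6_localWin_allFields L

end AllFields
/-! ## §4 The honest limit at the two roots: free chart fibres -/

/-- **`d0`: every permissible centre has a source-free chart** — for every `S` permissible at `d0` there is a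
chart `j ∈ S` in which NO low exponent `γ` (`γ ≠ 0`, `|γ| < 3`) has a source among the exponents of the chart
transform under translations of the fibre coordinates `S ∖ {j}` (empty source lists certify). [OURS · ‖ K] -/
theorem d0_sourceFree : ∀ S : Finset (Fin 4), permB 3 S d0.L = true →
    ∃ j ∈ S, ∀ γ ∈ lowExps 3, γ ≠ 0 → (∑ i, γ i) < 3 → sourcesB 3 S j (S.erase j) d0.L γ [] = true := by
  decide +kernel

/-- **`fc3`: every permissible centre has a source-free chart.** [OURS · ‖ K] -/
theorem fc3_sourceFree : ∀ S : Finset (Fin 4), permB 3 S fc3.L = true →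
    ∃ j ∈ S, ∀ γ ∈ lowExps 3, γ ≠ 0 → (∑ i, γ i) < 3 → sourcesB 3 S j (S.erase j) fc3.L γ [] = true := by
  decide +kernel

section FreeFibre

variable (L : Type) [Field L] [CharP L 3]

/-- **The free fibre at LOOP-D's root**: over EVERY field `L` of characteristic 3, whatever permissible centre `S`
A plays at `d0`, some chart `j ∈ S` has its WHOLE fibre over the current point (`b_j = 0`, `b = 0` off `S`)
consisting of equimultiple points — over an infinite `L`, infinitely many first replies for B.  (A statement
about the reach of finite row tables, not a B-win.) [OURS · ‖ K] -/
theorem d0_free_fibre (S : Finset (Fin 4)) (hS : IsPermissibleCentre 3 S (liftState L d0.toState).F) :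
    ∃ j ∈ S, ∀ b : Fin 4 → L, b j = 0 → (∀ i : Fin 4, i ∉ S → b i = 0) →
      IsEquimultiplePoint 3 S j b (liftState L d0.toState) := by
  have hperm : permB 3 S d0.L = true :=
    (isPermissibleCentre_iff 3 S d0.L).mp ((BaseChange.isPermissibleCentre_map_iff (φ3 L) 3 S d0.toState.F).mp hS)
  obtain ⟨j, hj, hcert⟩ := d0_sourceFree S hperm
  refine ⟨j, hj, fun b hbj hb => ?_⟩
  exact isEquimultiplePoint_of_sources (f := φ3 L) (fun _ => []) hcert (vanish_erase L hbj hb)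
    (fun _ h => absurd rfl h)

/-- **The free fibre at F3's `fc3`** (`x₃⁵x₄² + x₁x₂x₄⁴`, `exc = {x₁,x₂}`): same statement. [OURS · ‖ K] -/
theorem fc3_free_fibre (S : Finset (Fin 4)) (hS : IsPermissibleCentre 3 S (liftState L fc3.toState).F) :
    ∃ j ∈ S, ∀ b : Fin 4 → L, b j = 0 → (∀ i : Fin 4, i ∉ S → b i = 0) →
      IsEquimultiplePoint 3 S j b (liftState L fc3.toState) := by
  have hperm : permB 3 S fc3.L = true :=
    (isPermissibleCentre_iff 3 S fc3.L).mp ((BaseChange.isPermissibleCentre_map_iff (φ3 L) 3 S fc3.toState.F).mp hS)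
  obtain ⟨j, hj, hcert⟩ := fc3_sourceFree S hperm
  refine ⟨j, hj, fun b hbj hb => ?_⟩
  exact isEquimultiplePoint_of_sources (f := φ3 L) (fun _ => []) hcert (vanish_erase L hbj hb)
    (fun _ h => absurd rfl h)

end FreeFibre

end LoopCLocal

end Summit.ResolutionOfSingularities.ResolutionOfSingularities.Theorems.PIDim4

end
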